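import Mathlib

/-!
# Mahler's inequality `M(P') ≤ n · M(P)` (venture `DiscreteObjects`, target L)

Cell `pub-namedobj`, seat `pub-namedobj-mahler-g26`. Framing: lottery ticket; floor = certified bounds/negative ranges.

**Theorem** (`mahlerMeasure_derivative_le`; [cite: Mahler1961Derivative] K. Mahler, *On the zeros of the
derivative of a polynomial*, Proc. Roy. Soc. London Ser. A 264 (1961) 145–154; [cite: MckeeSmyth2021, Prop. 1.17]
McKee–Smyth, *Around the Unit Circle*).  For every `P ∈ ℂ[X]` of degree `n`, `M(P') ≤ n · M(P)` (Mathlib's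
`Polynomial.mahlerMeasure`).

Kernel proof (REPLICATION of a classical theorem; elementary route of Queffélec–Zarouf, *On Bernstein's
inequality for polynomials*, Anal. Math. Phys. 9 (2019), §5 Thm 5.1 with Lemma 3.3, here WITHOUT the maximum
modulus principle): write `P = c · ∏_{|a| ≤ 1} (X - a) · ∏_{|a| > 1} (X - a)` over its roots and REFLECT the outside
roots, `Q = c · ∏_{|a| ≤ 1} (X - a) · ∏_{|a| > 1} (1 - conj a · X)`.  Then `|P(z)| ≤ |Q(z)|` for `|z| ≥ 1`
(factorwise: `|1 - conj a z|² - |z - a|² = (|z|² - 1)(|a|² - 1)`), all roots of `Q` lie in the closed unit disc,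
`deg Q = n` and `|lead Q| = M(P)`.  GAUSS–LUCAS (Mathlib, `Polynomial.rootSet_derivative_subset_convexHull_rootSet`)
applied to `w Q - P` (`|w| > 1`; all its roots lie in the closed disc) gives `|P'(z)| ≤ |Q'(z)|` for `|z| > 1`,
hence on `|z| = 1` by continuity; the Mahler measure is monotone under domination on the unit circle
(`Polynomial.logMahlerMeasure` is a circle average), and `M(Q') = |lead Q'| = n |lead Q| = n M(P)` because the
roots of `Q'` lie in the closed disc (Gauss–Lucas again).  Used by the cell's `FewnomialHeightBound`
(Dobrowolski–Smyth 2017, Thm 1: `M(f) ≥ h(f)/2^{k-2}` for `k`-nomials), which discharges the Literature named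
fact `Literature.NumberTheory.MahlerMeasure.FewnomialHeightMahlerBound`.
-/

namespace Summit.Ventures.DiscreteObjects.Mahler

open Polynomial ComplexConjugate

/-! ### Factorwise comparison of `|z - a|` and `|1 - conj a · z|` -/

/-- `‖-conj a * z + 1‖² - ‖z - a‖² = (‖z‖² - 1)(‖a‖² - 1)`. -/
theorem norm_sq_reflect_sub (z a : ℂ) :
    ‖-conj a * z + 1‖ ^ 2 - ‖z - a‖ ^ 2 = (‖z‖ ^ 2 - 1) * (‖a‖ ^ 2 - 1) := by
  rw [Complex.sq_norm, Complex.sq_norm, Complex.sq_norm, Complex.sq_norm]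
  simp only [Complex.normSq_apply, Complex.sub_re, Complex.sub_im, Complex.add_re, Complex.add_im,
    Complex.one_re, Complex.one_im, Complex.mul_re, Complex.mul_im, Complex.neg_re, Complex.neg_im,
    Complex.conj_re, Complex.conj_im]
  ring

/-- For `‖z‖ ≥ 1` and `‖a‖ ≥ 1`: `‖z - a‖ ≤ ‖-conj a * z + 1‖` (the reflected factor dominates off the disc). -/
theorem norm_sub_le_norm_reflect {z a : ℂ} (hz : 1 ≤ ‖z‖) (ha : 1 ≤ ‖a‖) :
    ‖z - a‖ ≤ ‖-conj a * z + 1‖ := by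
  have h := norm_sq_reflect_sub z a
  have h1 : 0 ≤ (‖z‖ ^ 2 - 1) * (‖a‖ ^ 2 - 1) := mul_nonneg (by nlinarith) (by nlinarith)
  nlinarith [norm_nonneg (z - a), norm_nonneg (-conj a * z + 1)]

/-- The product of reflected linear factors dominates the product of the factors `X - a` off the unit disc. -/
theorem norm_eval_prod_X_sub_C_le_reflect (S : Multiset ℂ) (hS : ∀ a ∈ S, 1 ≤ ‖a‖) {z : ℂ}
    (hz : 1 ≤ ‖z‖) :
    ‖eval z (S.map fun a => X - C a).prod‖ ≤
      ‖eval z (S.map fun a => C (-conj a) * X + C 1).prod‖ := by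
  induction S using Multiset.induction_on with
  | empty => simp
  | cons b S ih =>
    have hb : 1 ≤ ‖b‖ := hS b (Multiset.mem_cons_self _ _)
    have ih' := ih (fun a ha => hS a (Multiset.mem_cons_of_mem ha))
    simp only [Multiset.map_cons, Multiset.prod_cons, eval_mul, norm_mul, eval_sub, eval_X, eval_C,
      eval_add]
    exact mul_le_mul (norm_sub_le_norm_reflect hz hb) ih' (norm_nonneg _) (norm_nonneg _)

/-- A reflected linear factor `-conj a · X + 1` is a nonzero polynomial. -/
theorem reflect_factor_ne_zero (a : ℂ) : (C (-conj a) * X + C 1 : ℂ[X]) ≠ 0 := by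
  intro h
  have := congrArg (eval 0) h
  simp at this

/-- The roots of a product of reflected factors `-conj a · X + 1`, `‖a‖ > 1`, lie in the OPEN unit disc. -/
theorem norm_lt_one_of_eval_reflect_prod_eq_zero (S : Multiset ℂ) (hS : ∀ a ∈ S, 1 < ‖a‖) {z : ℂ}
    (hz : eval z (S.map fun a => C (-conj a) * X + C 1).prod = 0) : ‖z‖ < 1 := by
  rw [eval_multiset_prod, Multiset.map_map, Multiset.prod_eq_zero_iff, Multiset.mem_map] at hz
  obtain ⟨a, ha, h0⟩ := hz
  simp only [Function.comp_apply, eval_add, eval_mul, eval_C, eval_X] at h0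
  have ha1 := hS a ha
  have h1 : conj a * z = 1 := by linear_combination -h0
  have h2 : ‖a‖ * ‖z‖ = 1 := by
    have := congrArg (fun w : ℂ => ‖w‖) h1
    simpa [norm_mul] using this
  by_contra hcon
  push Not at hcon
  nlinarith [norm_nonneg z]

/-- Degree of a product of reflected factors (`a ≠ 0` throughout): one per factor. -/
theorem natDegree_reflect_prod (S : Multiset ℂ) (hS : ∀ a ∈ S, a ≠ 0) :
    ((S.map fun a => C (-conj a) * X + C 1).prod).natDegree = Multiset.card S := by
  induction S using Multiset.induction_on with
  | empty => simp
  | cons b S ih =>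
    have hb : b ≠ 0 := hS b (Multiset.mem_cons_self _ _)
    have ih' := ih (fun a ha => hS a (Multiset.mem_cons_of_mem ha))
    have hb' : -conj b ≠ 0 := neg_ne_zero.2 ((_root_.map_ne_zero _).2 hb)
    rw [Multiset.map_cons, Multiset.prod_cons, natDegree_mul (reflect_factor_ne_zero b)
      (Multiset.prod_ne_zero fun h => ?_), ih', natDegree_add_C, natDegree_C_mul_X _ hb',
      Multiset.card_cons, add_comm]
    rw [Multiset.mem_map] at h
    obtain ⟨a, -, ha⟩ := h
    exact reflect_factor_ne_zero a ha

/-- Leading coefficient of a product of reflected factors: `∏ ‖a‖` in modulus. -/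
theorem norm_leadingCoeff_reflect_prod (S : Multiset ℂ) (hS : ∀ a ∈ S, a ≠ 0) :
    ‖((S.map fun a => C (-conj a) * X + C 1).prod).leadingCoeff‖ = (S.map fun a => ‖a‖).prod := by
  induction S using Multiset.induction_on with
  | empty => simp
  | cons b S ih =>
    have hb : b ≠ 0 := hS b (Multiset.mem_cons_self _ _)
    have ih' := ih (fun a ha => hS a (Multiset.mem_cons_of_mem ha))
    have hb' : -conj b ≠ 0 := neg_ne_zero.2 ((_root_.map_ne_zero _).2 hb)
    rw [Multiset.map_cons, Multiset.prod_cons, leadingCoeff_mul, norm_mul, ih', Multiset.map_cons,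
      Multiset.prod_cons, leadingCoeff_add_of_degree_lt' (degree_C_lt_degree_C_mul_X hb'),
      leadingCoeff_C_mul_X, norm_neg, Complex.norm_conj]

/-! ### Gauss–Lucas in disc form, continuity to the circle, monotonicity of `M` -/

/-- **Gauss–Lucas, disc form.**  If all roots of a nonconstant `R ∈ ℂ[X]` lie in the closed unit disc, so do
the roots of `R'` (the closed disc is convex; Mathlib's `rootSet_derivative_subset_convexHull_rootSet`). -/
theorem norm_le_one_of_isRoot_derivative {R : ℂ[X]} (hR : 0 < R.degree)
    (h : ∀ z : ℂ, R.IsRoot z → ‖z‖ ≤ 1) {z : ℂ} (hz : R.derivative.IsRoot z) : ‖z‖ ≤ 1 := by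
  have hR' : R.derivative ≠ 0 := by
    rw [Ne, derivative_eq_zero]
    exact (natDegree_pos_iff_degree_pos.2 hR).ne'
  have hz' : z ∈ R.derivative.rootSet ℂ := by
    rw [mem_rootSet, coe_aeval_eq_eval]
    exact ⟨hR', hz⟩
  have hsub : R.rootSet ℂ ⊆ Metric.closedBall (0 : ℂ) 1 := by
    intro x hx
    rw [mem_rootSet, coe_aeval_eq_eval] at hx
    simpa [Metric.mem_closedBall, dist_zero_right] using h x hx.2
  have := (convexHull_min hsub (convex_closedBall (0 : ℂ) 1))
    (rootSet_derivative_subset_convexHull_rootSet hR hz')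
  simpa [Metric.mem_closedBall] using this

/-- The Mahler measure of a polynomial all of whose roots lie in the closed unit disc is the modulus of its
leading coefficient (Jensen). -/
theorem mahlerMeasure_eq_norm_leadingCoeff_of_roots_le {R : ℂ[X]} (h : ∀ z : ℂ, R.IsRoot z → ‖z‖ ≤ 1) :
    R.mahlerMeasure = ‖R.leadingCoeff‖ := by
  by_cases hR : R = 0
  · simp [hR]
  rw [mahlerMeasure_eq_leadingCoeff_mul_prod_roots]
  have : (R.roots.map (fun a ↦ max 1 ‖a‖)).prod = 1 := by
    apply Multiset.prod_eq_one
    intro x hx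
    rw [Multiset.mem_map] at hx
    obtain ⟨a, ha, rfl⟩ := hx
    exact max_eq_left (h a ((mem_roots hR).1 ha))
  rw [this, mul_one]

/-- An inequality `‖f(z)‖ ≤ ‖g(z)‖` valid for `‖z‖ > 1` persists on the unit circle (continuity along rays). -/
theorem norm_eval_le_on_circle_of_exterior {f g : ℂ[X]}
    (h : ∀ z : ℂ, 1 < ‖z‖ → ‖f.eval z‖ ≤ ‖g.eval z‖) {z : ℂ} (hz : ‖z‖ = 1) :
    ‖f.eval z‖ ≤ ‖g.eval z‖ := by
  set φ : ℝ → ℝ := fun t => ‖g.eval ((t : ℂ) * z)‖ - ‖f.eval ((t : ℂ) * z)‖ with hφ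
  have hcont : Continuous φ := by
    have h1 : Continuous fun t : ℝ => ((t : ℂ) * z) := by fun_prop
    exact (continuous_norm.comp (g.continuous.comp h1)).sub (continuous_norm.comp (f.continuous.comp h1))
  have hev : ∀ᶠ t in nhdsWithin (1 : ℝ) (Set.Ioi 1), 0 ≤ φ t := by
    filter_upwards [self_mem_nhdsWithin] with t ht
    have ht' : (1 : ℝ) < t := ht
    have ht1 : 1 < ‖(t : ℂ) * z‖ := by
      rw [norm_mul, hz, mul_one, Complex.norm_real, Real.norm_eq_abs, abs_of_pos (by linarith)]
      exact ht'
    have := h _ ht1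
    simp only [hφ]
    linarith
  have htend : Filter.Tendsto φ (nhdsWithin (1 : ℝ) (Set.Ioi 1)) (nhds (φ 1)) :=
    (hcont.tendsto 1).mono_left nhdsWithin_le_nhds
  have h0 := ge_of_tendsto htend hev
  simp only [hφ, Complex.ofReal_one, one_mul] at h0
  linarith

/-- **Monotonicity of the Mahler measure under domination on the unit circle:** if `‖f(z)‖ ≤ ‖g(z)‖` for all
`‖z‖ = 1` (and `g ≠ 0`) then `M(f) ≤ M(g)` (`log M` is the circle average of `log ‖·‖`; the roots of `f` on the
circle, where Mathlib's `log 0 = 0` spoils the pointwise comparison, form a finite — hence codiscrete — set). -/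
theorem mahlerMeasure_le_of_norm_eval_le {f g : ℂ[X]} (hg : g ≠ 0)
    (h : ∀ z : ℂ, ‖z‖ = 1 → ‖f.eval z‖ ≤ ‖g.eval z‖) : f.mahlerMeasure ≤ g.mahlerMeasure := by
  classical
  by_cases hf : f = 0
  · rw [hf, mahlerMeasure_zero]
    exact mahlerMeasure_nonneg g
  have hfpos : 0 < f.mahlerMeasure := mahlerMeasure_pos_of_ne_zero hf
  have hgpos : 0 < g.mahlerMeasure := mahlerMeasure_pos_of_ne_zero hg
  rw [← Real.log_le_log_iff hfpos hgpos, ← logMahlerMeasure_eq_log_MahlerMeasure,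
    ← logMahlerMeasure_eq_log_MahlerMeasure, logMahlerMeasure_def, logMahlerMeasure_def]
  set F : ℂ → ℝ := fun x => if eval x f = 0 then 0 else Real.log ‖eval x g‖ with hF
  have hfin : ((f.roots.toFinset : Finset ℂ) : Set ℂ).Finite := Finset.finite_toSet _
  have hEq : F =ᶠ[Filter.codiscreteWithin (Metric.sphere (0 : ℂ) |1|)] (fun x => Real.log ‖eval x g‖) := by
    apply Filter.eventually_of_mem (compl_finite_mem_codiscreteWithin hfin)
    intro x hx
    have hx' : eval x f ≠ 0 := by
      intro h0
      apply hx
      simp only [Finset.mem_coe, Multiset.mem_toFinset]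
      exact (mem_roots hf).2 h0
    simp [hF, hx']
  have hIf : CircleIntegrable (fun x => Real.log ‖eval x f‖) 0 1 := f.intervalIntegrable_mahlerMeasure
  have hIg : CircleIntegrable (fun x => Real.log ‖eval x g‖) 0 1 := g.intervalIntegrable_mahlerMeasure
  have hIF : CircleIntegrable F 0 1 := hIg.congr_codiscreteWithin hEq.symm
  calc Real.circleAverage (fun x ↦ Real.log ‖eval x f‖) 0 1 ≤ Real.circleAverage F 0 1 := by
        apply Real.circleAverage_mono hIf hIF
        intro x hx
        have hx1 : ‖x‖ = 1 := by simpa using hx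
        simp only [hF]
        split_ifs with h0
        · simp [h0]
        · exact Real.log_le_log (norm_pos_iff.2 h0) (h x hx1)
    _ = Real.circleAverage (fun x ↦ Real.log ‖eval x g‖) 0 1 :=
        Real.circleAverage_congr_codiscreteWithin hEq one_ne_zero

/-! ### The derivative comparison (Bernstein–de Bruijn–Queffélec–Zarouf lemma, special form) -/

/-- **Derivative domination off the disc.**  Let `P, Q ∈ ℂ[X]` with `deg P ≤ deg Q`, `deg Q ≥ 1`,
`‖lead P‖ ≤ ‖lead Q‖`, `‖P(z)‖ ≤ ‖Q(z)‖` for `‖z‖ ≥ 1`, and all roots of `Q` in the closed unit disc.  Then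
`‖P'(z)‖ ≤ ‖Q'(z)‖` for every `‖z‖ > 1`.  (If `‖Q'(z)‖ < ‖P'(z)‖`, put `w = P'(z)/Q'(z)`, `|w| > 1`: the
polynomial `w Q - P` has degree `deg Q ≥ 1` and all its roots in the closed disc, so by Gauss–Lucas its
derivative `w Q' - P'` cannot vanish at `z` — but it does.) -/
theorem norm_eval_derivative_le_of_dominated {P Q : ℂ[X]} (hdeg : P.natDegree ≤ Q.natDegree)
    (hQ0 : 0 < Q.natDegree) (hlead : ‖P.leadingCoeff‖ ≤ ‖Q.leadingCoeff‖)
    (hdom : ∀ z : ℂ, 1 ≤ ‖z‖ → ‖P.eval z‖ ≤ ‖Q.eval z‖) (hroots : ∀ z : ℂ, Q.IsRoot z → ‖z‖ ≤ 1)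
    {z : ℂ} (hz : 1 < ‖z‖) : ‖P.derivative.eval z‖ ≤ ‖Q.derivative.eval z‖ := by
  by_contra hlt
  push Not at hlt
  have hQdeg : 0 < Q.degree := natDegree_pos_iff_degree_pos.1 hQ0
  have hQne : Q ≠ 0 := by
    rintro rfl
    simp at hQ0
  have hQ'z : Q.derivative.eval z ≠ 0 := by
    intro h0
    have := norm_le_one_of_isRoot_derivative hQdeg hroots (z := z) h0
    linarith
  set w : ℂ := P.derivative.eval z / Q.derivative.eval z with hw
  have hwpos : 0 < ‖Q.derivative.eval z‖ := norm_pos_iff.2 hQ'z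
  have hw1 : 1 < ‖w‖ := by
    rw [hw, norm_div, lt_div_iff₀ hwpos, one_mul]
    exact hlt
  set R : ℂ[X] := C w * Q - P with hR
  -- the top coefficient of `R` does not cancel
  have hcoef : R.coeff Q.natDegree ≠ 0 := by
    intro h0
    rw [hR, coeff_sub, coeff_C_mul, coeff_natDegree, sub_eq_zero] at h0
    have h1 : ‖P.coeff Q.natDegree‖ ≤ ‖P.leadingCoeff‖ := by
      rcases hdeg.eq_or_lt with h | h
      · rw [← h, coeff_natDegree]
      · rw [coeff_eq_zero_of_natDegree_lt h, norm_zero]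
        exact norm_nonneg _
    have h2 : ‖w * Q.leadingCoeff‖ = ‖P.coeff Q.natDegree‖ := by rw [h0]
    rw [norm_mul] at h2
    have h3 : 0 < ‖Q.leadingCoeff‖ := norm_pos_iff.2 (leadingCoeff_ne_zero.2 hQne)
    nlinarith
  have hRne : R ≠ 0 := fun h => hcoef (by rw [h, coeff_zero])
  have hRdeg : 0 < R.degree := by
    have h1 : Q.natDegree ≤ R.natDegree := le_natDegree_of_ne_zero hcoef
    exact natDegree_pos_iff_degree_pos.1 (lt_of_lt_of_le hQ0 h1)
  -- all roots of `R` lie in the closed unit disc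
  have hRroots : ∀ x : ℂ, R.IsRoot x → ‖x‖ ≤ 1 := by
    intro x hx
    by_contra hx1
    push Not at hx1
    have hx0 : eval x R = 0 := hx
    rw [hR, eval_sub, eval_mul, eval_C, sub_eq_zero] at hx0
    have h1 : ‖w‖ * ‖Q.eval x‖ = ‖P.eval x‖ := by rw [← norm_mul, hx0]
    have h2 := hdom x hx1.le
    have hQx : Q.eval x ≠ 0 := by
      intro h0
      have := hroots x h0
      linarith
    have h3 : 0 < ‖Q.eval x‖ := norm_pos_iff.2 hQx
    nlinarith
  -- but `R'(z) = 0` with `‖z‖ > 1`: contradiction with Gauss–Lucas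
  have hR'z : R.derivative.IsRoot z := by
    show eval z (derivative R) = 0
    rw [hR, derivative_sub, derivative_mul, derivative_C, zero_mul, zero_add, eval_sub, eval_mul, eval_C,
      hw, div_mul_cancel₀ _ hQ'z, sub_self]
  have := norm_le_one_of_isRoot_derivative hRdeg hRroots hR'z
  linarith

/-! ### Mahler's theorem -/

/-- **Mahler's inequality (1961): `M(P') ≤ deg P · M(P)` for every complex polynomial `P`.**
REPLICATION in the kernel of K. Mahler, Proc. Roy. Soc. London A 264 (1961) 145–154 (= McKee–Smyth,
*Around the Unit Circle*, Prop. 1.17), by root reflection + Gauss–Lucas (module docstring). -/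
theorem mahlerMeasure_derivative_le (P : ℂ[X]) :
    P.derivative.mahlerMeasure ≤ (P.natDegree : ℝ) * P.mahlerMeasure := by
  classical
  by_cases hn : P.natDegree = 0
  · rw [derivative_eq_zero.2 hn, hn]
    simp
  have hP : P ≠ 0 := fun h => hn (by rw [h, natDegree_zero])
  set c := P.leadingCoeff with hc
  have hc0 : c ≠ 0 := leadingCoeff_ne_zero.2 hP
  set Sin := P.roots.filter (fun a => ‖a‖ ≤ 1) with hSin
  set Sout := P.roots.filter (fun a => ¬ ‖a‖ ≤ 1) with hSout
  have hSout1 : ∀ a ∈ Sout, 1 < ‖a‖ := fun a ha => not_le.1 (Multiset.mem_filter.1 ha).2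
  have hSout0 : ∀ a ∈ Sout, a ≠ 0 := by
    intro a ha h0
    have := hSout1 a ha
    rw [h0, norm_zero] at this
    linarith
  have hSin1 : ∀ a ∈ Sin, ‖a‖ ≤ 1 := fun a ha => (Multiset.mem_filter.1 ha).2
  set A : ℂ[X] := C c * (Sin.map fun a => X - C a).prod with hA
  set B : ℂ[X] := (Sout.map fun a => X - C a).prod with hB
  set Bs : ℂ[X] := (Sout.map fun a => C (-conj a) * X + C 1).prod with hBs
  have hmonIn : (Sin.map fun a => X - C a).prod.Monic :=
    monic_multiset_prod_of_monic _ _ (fun a _ => monic_X_sub_C a)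
  have hmonB : B.Monic := monic_multiset_prod_of_monic _ _ (fun a _ => monic_X_sub_C a)
  have hPfac : P = A * B := by
    conv_lhs => rw [(IsAlgClosed.splits P).eq_prod_roots]
    rw [hA, hB, mul_assoc, ← Multiset.prod_add, ← Multiset.map_add, Multiset.filter_add_not]
  set Q : ℂ[X] := A * Bs with hQ
  have hA0 : A ≠ 0 := mul_ne_zero (C_ne_zero.2 hc0) hmonIn.ne_zero
  have hBs0 : Bs ≠ 0 := by
    refine Multiset.prod_ne_zero fun h => ?_
    rw [Multiset.mem_map] at h
    obtain ⟨a, -, ha⟩ := h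
    exact reflect_factor_ne_zero a ha
  -- roots of `A` and of `Q` lie in the closed disc
  have hAroots : ∀ z : ℂ, A.eval z = 0 → ‖z‖ ≤ 1 := by
    intro z hz
    rw [hA, eval_mul, eval_C, mul_eq_zero] at hz
    rcases hz with h | h
    · exact absurd h hc0
    rw [eval_multiset_prod, Multiset.map_map, Multiset.prod_eq_zero_iff, Multiset.mem_map] at h
    obtain ⟨a, ha, h0⟩ := h
    simp only [Function.comp_apply, eval_sub, eval_X, eval_C, sub_eq_zero] at h0
    rw [h0]
    exact hSin1 a ha
  have hQroots : ∀ z : ℂ, Q.IsRoot z → ‖z‖ ≤ 1 := by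
    intro z hz
    have hz0 : eval z Q = 0 := hz
    rw [hQ, eval_mul, mul_eq_zero] at hz0
    rcases hz0 with h | h
    · exact hAroots z h
    · exact (norm_lt_one_of_eval_reflect_prod_eq_zero Sout hSout1 h).le
  -- degrees
  have hdegB : B.natDegree = Multiset.card Sout := by
    rw [hB, natDegree_multiset_prod_of_monic _ (fun f hf => ?_)]
    · simp only [Multiset.map_map, Function.comp_def, natDegree_X_sub_C, Multiset.map_const',
        Multiset.sum_replicate, smul_eq_mul, mul_one]
    · rw [Multiset.mem_map] at hf
      obtain ⟨a, -, rfl⟩ := hf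
      exact monic_X_sub_C a
  have hdegBs : Bs.natDegree = Multiset.card Sout := natDegree_reflect_prod Sout hSout0
  have hQn : Q.natDegree = P.natDegree := by
    rw [hQ, hPfac, natDegree_mul hA0 hBs0, natDegree_mul hA0 hmonB.ne_zero, hdegB, hdegBs]
  have hQ0 : 0 < Q.natDegree := by
    rw [hQn]
    exact Nat.pos_of_ne_zero hn
  have hQne : Q ≠ 0 := mul_ne_zero hA0 hBs0
  -- the leading coefficient of `Q` has modulus `M(P)`
  have hleadA : ‖A.leadingCoeff‖ = ‖c‖ := by
    rw [hA, leadingCoeff_mul, leadingCoeff_C, hmonIn.leadingCoeff, mul_one]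
  have hleadQ : ‖Q.leadingCoeff‖ = P.mahlerMeasure := by
    rw [hQ, leadingCoeff_mul, norm_mul, hleadA, hBs, norm_leadingCoeff_reflect_prod Sout hSout0,
      mahlerMeasure_eq_leadingCoeff_mul_prod_roots, ← hc]
    congr 1
    conv_rhs => rw [← Multiset.filter_add_not (fun a : ℂ => ‖a‖ ≤ 1) P.roots, Multiset.map_add,
      Multiset.prod_add]
    rw [← hSin, ← hSout]
    have h1 : (Sin.map fun a => max 1 ‖a‖).prod = 1 := by
      apply Multiset.prod_eq_one
      intro x hx
      rw [Multiset.mem_map] at hx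
      obtain ⟨a, ha, rfl⟩ := hx
      exact max_eq_left (hSin1 a ha)
    have h2 : (Sout.map fun a => max 1 ‖a‖) = Sout.map fun a => ‖a‖ := by
      apply Multiset.map_congr rfl
      intro a ha
      exact max_eq_right (hSout1 a ha).le
    rw [h1, one_mul, h2]
  have hlead : ‖P.leadingCoeff‖ ≤ ‖Q.leadingCoeff‖ := by
    rw [hleadQ]
    exact leadingCoeff_le_mahlerMeasure P
  -- domination `‖P‖ ≤ ‖Q‖` off the open disc
  have hdomPQ : ∀ z : ℂ, 1 ≤ ‖z‖ → ‖P.eval z‖ ≤ ‖Q.eval z‖ := by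
    intro z hz
    have e1 : eval z P = eval z A * eval z B := by rw [hPfac]; exact eval_mul
    have e2 : eval z Q = eval z A * eval z Bs := eval_mul
    rw [e1, e2, norm_mul, norm_mul]
    exact mul_le_mul_of_nonneg_left
      (norm_eval_prod_X_sub_C_le_reflect Sout (fun a ha => (hSout1 a ha).le) hz) (norm_nonneg (eval z A))
  -- derivative domination, off the disc and then on the circle
  have hder : ∀ z : ℂ, 1 < ‖z‖ → ‖P.derivative.eval z‖ ≤ ‖Q.derivative.eval z‖ := fun z hz =>
    norm_eval_derivative_le_of_dominated hQn.ge hQ0 hlead hdomPQ hQroots hz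
  have hcirc : ∀ z : ℂ, ‖z‖ = 1 → ‖P.derivative.eval z‖ ≤ ‖Q.derivative.eval z‖ := fun z hz =>
    norm_eval_le_on_circle_of_exterior hder hz
  have hQ'ne : Q.derivative ≠ 0 := derivative_ne_zero.2 hQ0.ne'
  -- `M(Q') = n · M(P)` (roots of `Q'` in the closed disc by Gauss–Lucas)
  have hQ'roots : ∀ z : ℂ, Q.derivative.IsRoot z → ‖z‖ ≤ 1 := fun z hz =>
    norm_le_one_of_isRoot_derivative (natDegree_pos_iff_degree_pos.1 hQ0) hQroots hz
  have hMQ' : Q.derivative.mahlerMeasure = (P.natDegree : ℝ) * P.mahlerMeasure := by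
    rw [mahlerMeasure_eq_norm_leadingCoeff_of_roots_le hQ'roots, leadingCoeff_derivative, norm_mul,
      Complex.norm_natCast, hleadQ, hQn, mul_comm]
  calc P.derivative.mahlerMeasure ≤ Q.derivative.mahlerMeasure :=
        mahlerMeasure_le_of_norm_eval_le hQ'ne hcirc
    _ = (P.natDegree : ℝ) * P.mahlerMeasure := hMQ'

end Summit.Ventures.DiscreteObjects.Mahler
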